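import Summits.CriticalPhenomena.PercolationContinuityZ3.Theorems.PercNearOneGluingNoHeavyLowerTailKnQuestion8CoefficientwiseIslandMax
import HarnessLib

/-!
# Islands V: the ISLAND SWAP — colourings with `w` sealed inside the largest `u`-avoiding island cancel (prim-lf-2 gen 37)

Support file (`--supports stmt-CriticalPhenomena-4575`, closed), prover `prim-lf-2` (gen 37).  No definitions, no named facts,
no sorries; standard axioms.  Memo `prim-lf-2/CW-RESIDUE-gen36.md` §2.8 (pencil + census there; kernel here) and `prim-lf-2/CW-SECTORS-gen37.md`.

Setting as in …CoefficientwiseIsland / …IslandMax: multigraph `ends : ι → Sym2 V`, vertex finset `Vs ∋ x`, edge set `E`, root `x`,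
points `u ≠ x` and `w`, wall set `Z`; colourings `s ⊆ E` (red) / `E \ s` (blue); `C(t) = openCluster (ends '' t) x`;
`σ_v(s) = 1[v ∈ C(s)] − 1[v ∈ C(E \ s)]`; point row `P = Σ_{s : Z off the zone} σ_u σ_w`.  An ISLAND of `s` is `Y ∋ x` all of whose
boundary vertices are red- AND blue-reachable from `x` inside `Y`; here islands avoid the point `u` (not `w`): `Y^u(s)` denotes the union of
all islands `Y ⊆ Vs` with `x ∈ Y ∌ u` (…IslandMax `islandSup_eq_iff` with the roles of the two points exchanged), and `E_Y` the edges inside `Y`.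
THE ISLAND SWAP recolours every edge inside `Y^u(s)`:  `ψ(s) = s ∆ E_{Y^u(s)}`.
* `Coefficientwise.islandSup_islandSwap` — `Y^u(ψ s) = Y^u(s)` (the island condition is colour-symmetric; islands above `Y^u` are islands of
  the quotient, which `ψ` does not change — Lemma B);
* `Coefficientwise.islandSwap_outside` / `islandSwap_inside` — outside an island the two clusters are unchanged by the swap, inside they are
  exchanged (Lemma A);
* `Coefficientwise.pointRow_sum_sealed_eq_zero` — **ISLAND SWAP**: `Σ_{s : wall, w ∈ Y^u(s)} σ_u σ_w = 0` (`ψ` is a wall-preserving involution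
  on these colourings fixing `σ_u` and negating `σ_w`);
* `Coefficientwise.pointRow_eq_sum_unsealed` — hence `P = Σ_{s : wall, w ∉ Y^u(s)} σ_u σ_w`: only colourings in which `w` is NOT sealed inside
  the largest `u`-avoiding island carry the point row (a second exact cancellation, independent of the A*-free one of …AttachmentResidue).
[cite: KozmaNitzan2024, Questions 8–9 (§5.5 p. 36) (context: the Question-8 pocket covariance programme)]
-/

namespace Summit.CriticalPhenomena.PercolationContinuityZ3.Theorems

open Finset Literature.Probability.Percolation
open scoped symmDiff

namespace Coefficientwise

variable {ι V : Type*}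

open Classical in
/-- Swapping the colours inside `T`: the red edges inside `T` become the old blue edges inside `T`. [this work; finset bookkeeping] -/
theorem islandSwap_filter_red (ends : ι → Sym2 V) (E s : Finset ι) (hs : s ⊆ E) (T : Finset V) :
    ((s ∆ (E).filter (fun i => ∀ y ∈ ends i, y ∈ T))).filter (fun i => ∀ y ∈ ends i, y ∈ T) = (E \ s).filter (fun i => ∀ y ∈ ends i, y ∈ T) := by
  ext i
  simp only [Finset.mem_filter, Finset.mem_symmDiff, Finset.mem_sdiff]
  constructor
  · rintro ⟨h | h, hin⟩
    · exact absurd ⟨hs h.1, hin⟩ h.2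
    · exact ⟨⟨h.1.1, h.2⟩, hin⟩
  · rintro ⟨⟨hiE, his⟩, hin⟩
    exact ⟨Or.inr ⟨⟨hiE, hin⟩, his⟩, hin⟩

open Classical in
/-- Swapping the colours inside `T`: the blue edges inside `T` become the old red edges inside `T`. [this work; finset bookkeeping] -/
theorem islandSwap_filter_blue (ends : ι → Sym2 V) (E s : Finset ι) (hs : s ⊆ E) (T : Finset V) :
    (E \ (s ∆ (E).filter (fun i => ∀ y ∈ ends i, y ∈ T))).filter (fun i => ∀ y ∈ ends i, y ∈ T) = (s).filter (fun i => ∀ y ∈ ends i, y ∈ T) := by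
  ext i
  have hsi : i ∈ s → i ∈ E := fun h => hs h
  simp only [Finset.mem_filter, Finset.mem_symmDiff, Finset.mem_sdiff]
  tauto

open Classical in
/-- Swapping the colours inside `T` and then giving all of `E_T` to red is giving all of `E_T` to red. [this work; finset bookkeeping] -/
theorem islandSwap_union_red (ends : ι → Sym2 V) (E s : Finset ι) (hs : s ⊆ E) (T : Finset V) :
    (s ∆ (E).filter (fun i => ∀ y ∈ ends i, y ∈ T)) ∪ (E).filter (fun i => ∀ y ∈ ends i, y ∈ T) = s ∪ (E).filter (fun i => ∀ y ∈ ends i, y ∈ T) := by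
  ext i
  simp only [Finset.mem_union, Finset.mem_symmDiff, Finset.mem_filter]
  constructor
  · rintro ((h | h) | h)
    · exact Or.inl h.1
    · exact Or.inr h.1
    · exact Or.inr h
  · rintro (h | h)
    · by_cases hin : ∀ y ∈ ends i, y ∈ T
      · exact Or.inr ⟨hs h, hin⟩
      · exact Or.inl (Or.inl ⟨h, fun h' => hin h'.2⟩)
    · exact Or.inr h

open Classical in
/-- Swapping the colours inside `T` and then giving all of `E_T` to blue is giving all of `E_T` to blue. [this work; finset bookkeeping] -/
theorem islandSwap_union_blue (ends : ι → Sym2 V) (E s : Finset ι) (hs : s ⊆ E) (T : Finset V) :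
    (E \ (s ∆ (E).filter (fun i => ∀ y ∈ ends i, y ∈ T))) ∪ (E).filter (fun i => ∀ y ∈ ends i, y ∈ T) = (E \ s) ∪ (E).filter (fun i => ∀ y ∈ ends i, y ∈ T) := by
  ext i
  have hsi : i ∈ s → i ∈ E := fun h => hs h
  simp only [Finset.mem_union, Finset.mem_sdiff, Finset.mem_symmDiff, Finset.mem_filter]
  by_cases hin : ∀ y ∈ ends i, y ∈ T
  · constructor
    · rintro (h | h)
      · exact Or.inr ⟨h.1, hin⟩
      · exact Or.inr ⟨h.1, hin⟩
    · rintro (h | h)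
      · exact Or.inr ⟨h.1, hin⟩
      · exact Or.inr ⟨h.1, hin⟩
  · tauto

open Classical in
/-- The swapped colouring is again a subset of `E`. [this work; finset bookkeeping] -/
theorem islandSwap_subset (ends : ι → Sym2 V) (E s : Finset ι) (hs : s ⊆ E) (T : Finset V) :
    (s ∆ (E).filter (fun i => ∀ y ∈ ends i, y ∈ T)) ⊆ E := by
  intro i hi
  rw [Finset.mem_symmDiff] at hi
  rcases hi with h | h
  · exact hs h.1
  · exact (Finset.mem_filter.mp h.1).1

open Classical in
/-- **Outside an island the swap changes nothing** (Lemma A, outside form): if `T ∋ x` is an island of `s ⊆ E` and `v ∉ T`, then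
`v ∈ C(ψ s) ↔ v ∈ C(s)` and `v ∈ C(E \ ψ s) ↔ v ∈ C(E \ s)`, `ψ s = s ∆ E_T`. [cite: KozmaNitzan2024, §5.5 (context only)] -/
theorem islandSwap_outside (ends : ι → Sym2 V) (E s : Finset ι) (hs : s ⊆ E) (x : V) (T : Finset V) (hxT : x ∈ T)
    (hI : (∀ t ∈ T, t ≠ x → (∃ i ∈ E, ∃ t', ends i = s(t, t') ∧ t' ∉ T) → t ∈ openCluster (ends '' (↑((s).filter (fun i => ∀ y ∈ ends i, y ∈ T)) : Set ι)) x ∧ t ∈ openCluster (ends '' (↑((E \ s).filter (fun i => ∀ y ∈ ends i, y ∈ T)) : Set ι)) x)) {v : V} (hv : v ∉ T) :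
    (v ∈ openCluster (ends '' (↑((s ∆ (E).filter (fun i => ∀ y ∈ ends i, y ∈ T))) : Set ι)) x ↔ v ∈ openCluster (ends '' (↑(s) : Set ι)) x) ∧ (v ∈ openCluster (ends '' (↑(E \ (s ∆ (E).filter (fun i => ∀ y ∈ ends i, y ∈ T))) : Set ι)) x ↔ v ∈ openCluster (ends '' (↑(E \ s) : Set ι)) x) := by
  have hs' : (s ∆ (E).filter (fun i => ∀ y ∈ ends i, y ∈ T)) ⊆ E := islandSwap_subset ends E s hs T
  have hxT' : x ∈ (↑T : Set V) := Finset.mem_coe.mpr hxT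
  have hv' : v ∉ (↑T : Set V) := fun h => hv (Finset.mem_coe.mp h)
  -- one-colour island hypotheses in `Set` form
  have islS : ∀ c : Finset ι, (∀ t ∈ T, t ≠ x → (∃ i ∈ E, ∃ t', ends i = s(t, t') ∧ t' ∉ T) → t ∈ openCluster (ends '' (↑((c).filter (fun i => ∀ y ∈ ends i, y ∈ T)) : Set ι)) x) →
      (∀ t ∈ (↑T : Set V), t ≠ x → (∃ i ∈ E, ∃ t', ends i = s(t, t') ∧ t' ∉ (↑T : Set V)) →
        t ∈ openCluster (ends '' (↑((c).filter (fun i => ∀ y ∈ ends i, y ∈ (↑T : Set V))) : Set ι)) x) := by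
    intro c hc t ht htx hbd
    obtain ⟨i, hi, t', he, ht'⟩ := hbd
    have h := hc t (Finset.mem_coe.mp ht) htx ⟨i, hi, t', he, fun h => ht' (Finset.mem_coe.mpr h)⟩
    refine openCluster_image_mono ends ?_ x h
    intro j hj
    rw [Finset.mem_filter] at hj ⊢
    exact ⟨hj.1, fun y hy => Finset.mem_coe.mpr (hj.2 y hy)⟩
  have eT : (E).filter (fun i => ∀ y ∈ ends i, y ∈ (↑T : Set V)) = (E).filter (fun i => ∀ y ∈ ends i, y ∈ T) := Finset.filter_congr fun i _ => by simp only [Finset.mem_coe]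
  have hred : ∀ t ∈ T, t ≠ x → (∃ i ∈ E, ∃ t', ends i = s(t, t') ∧ t' ∉ T) → t ∈ openCluster (ends '' (↑((s).filter (fun i => ∀ y ∈ ends i, y ∈ T)) : Set ι)) x := fun t ht htx hbd => (hI t ht htx hbd).1
  have hblue : ∀ t ∈ T, t ≠ x → (∃ i ∈ E, ∃ t', ends i = s(t, t') ∧ t' ∉ T) → t ∈ openCluster (ends '' (↑((E \ s).filter (fun i => ∀ y ∈ ends i, y ∈ T)) : Set ι)) x := fun t ht htx hbd => (hI t ht htx hbd).2
  have hred' : ∀ t ∈ T, t ≠ x → (∃ i ∈ E, ∃ t', ends i = s(t, t') ∧ t' ∉ T) → t ∈ openCluster (ends '' (↑(((s ∆ (E).filter (fun i => ∀ y ∈ ends i, y ∈ T))).filter (fun i => ∀ y ∈ ends i, y ∈ T)) : Set ι)) x := by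
    rw [islandSwap_filter_red ends E s hs T]; exact hblue
  have hblue' : ∀ t ∈ T, t ≠ x → (∃ i ∈ E, ∃ t', ends i = s(t, t') ∧ t' ∉ T) → t ∈ openCluster (ends '' (↑((E \ (s ∆ (E).filter (fun i => ∀ y ∈ ends i, y ∈ T))).filter (fun i => ∀ y ∈ ends i, y ∈ T)) : Set ι)) x := by
    rw [islandSwap_filter_blue ends E s hs T]; exact hred
  have A1 := mem_openCluster_iff_union_of_island ends E s hs x (↑T : Set V) hxT' (islS s hred) hv'
  have A2 := mem_openCluster_iff_union_of_island ends E (E \ s) Finset.sdiff_subset x (↑T : Set V) hxT' (islS (E \ s) hblue) hv'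
  have A3 := mem_openCluster_iff_union_of_island ends E (s ∆ (E).filter (fun i => ∀ y ∈ ends i, y ∈ T)) hs' x (↑T : Set V) hxT' (islS _ hred') hv'
  have A4 := mem_openCluster_iff_union_of_island ends E (E \ (s ∆ (E).filter (fun i => ∀ y ∈ ends i, y ∈ T))) Finset.sdiff_subset x (↑T : Set V) hxT' (islS _ hblue') hv'
  rw [eT] at A1 A2 A3 A4
  rw [islandSwap_union_red ends E s hs T] at A3
  rw [islandSwap_union_blue ends E s hs T] at A4
  exact ⟨A3.trans A1.symm, A4.trans A2.symm⟩

open Classical in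
/-- **Inside an island the swap exchanges the two clusters** (Lemma A, inside form): if `T ∋ x` is an island of `s ⊆ E` and `v ∈ T`, then
`v ∈ C(ψ s) ↔ v ∈ C(E \ s)` and `v ∈ C(E \ ψ s) ↔ v ∈ C(s)`. [cite: KozmaNitzan2024, §5.5 (context only)] -/
theorem islandSwap_inside (ends : ι → Sym2 V) (E s : Finset ι) (hs : s ⊆ E) (x : V) (T : Finset V) (hxT : x ∈ T)
    (hI : (∀ t ∈ T, t ≠ x → (∃ i ∈ E, ∃ t', ends i = s(t, t') ∧ t' ∉ T) → t ∈ openCluster (ends '' (↑((s).filter (fun i => ∀ y ∈ ends i, y ∈ T)) : Set ι)) x ∧ t ∈ openCluster (ends '' (↑((E \ s).filter (fun i => ∀ y ∈ ends i, y ∈ T)) : Set ι)) x)) {v : V} (hv : v ∈ T) :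
    (v ∈ openCluster (ends '' (↑((s ∆ (E).filter (fun i => ∀ y ∈ ends i, y ∈ T))) : Set ι)) x ↔ v ∈ openCluster (ends '' (↑(E \ s) : Set ι)) x) ∧ (v ∈ openCluster (ends '' (↑(E \ (s ∆ (E).filter (fun i => ∀ y ∈ ends i, y ∈ T))) : Set ι)) x ↔ v ∈ openCluster (ends '' (↑(s) : Set ι)) x) := by
  have hs' : (s ∆ (E).filter (fun i => ∀ y ∈ ends i, y ∈ T)) ⊆ E := islandSwap_subset ends E s hs T
  have hxT' : x ∈ (↑T : Set V) := Finset.mem_coe.mpr hxT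
  have hv' : v ∈ (↑T : Set V) := Finset.mem_coe.mpr hv
  have islS : ∀ c : Finset ι, (∀ t ∈ T, t ≠ x → (∃ i ∈ E, ∃ t', ends i = s(t, t') ∧ t' ∉ T) → t ∈ openCluster (ends '' (↑((c).filter (fun i => ∀ y ∈ ends i, y ∈ T)) : Set ι)) x) →
      (∀ t ∈ (↑T : Set V), t ≠ x → (∃ i ∈ E, ∃ t', ends i = s(t, t') ∧ t' ∉ (↑T : Set V)) →
        t ∈ openCluster (ends '' (↑((c).filter (fun i => ∀ y ∈ ends i, y ∈ (↑T : Set V))) : Set ι)) x) := by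
    intro c hc t ht htx hbd
    obtain ⟨i, hi, t', he, ht'⟩ := hbd
    have h := hc t (Finset.mem_coe.mp ht) htx ⟨i, hi, t', he, fun h => ht' (Finset.mem_coe.mpr h)⟩
    refine openCluster_image_mono ends ?_ x h
    intro j hj
    rw [Finset.mem_filter] at hj ⊢
    exact ⟨hj.1, fun y hy => Finset.mem_coe.mpr (hj.2 y hy)⟩
  have eF : ∀ c : Finset ι, (c).filter (fun i => ∀ y ∈ ends i, y ∈ (↑T : Set V)) = (c).filter (fun i => ∀ y ∈ ends i, y ∈ T) :=
    fun c => Finset.filter_congr fun i _ => by simp only [Finset.mem_coe]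
  have hred : ∀ t ∈ T, t ≠ x → (∃ i ∈ E, ∃ t', ends i = s(t, t') ∧ t' ∉ T) → t ∈ openCluster (ends '' (↑((s).filter (fun i => ∀ y ∈ ends i, y ∈ T)) : Set ι)) x := fun t ht htx hbd => (hI t ht htx hbd).1
  have hblue : ∀ t ∈ T, t ≠ x → (∃ i ∈ E, ∃ t', ends i = s(t, t') ∧ t' ∉ T) → t ∈ openCluster (ends '' (↑((E \ s).filter (fun i => ∀ y ∈ ends i, y ∈ T)) : Set ι)) x := fun t ht htx hbd => (hI t ht htx hbd).2
  have hred' : ∀ t ∈ T, t ≠ x → (∃ i ∈ E, ∃ t', ends i = s(t, t') ∧ t' ∉ T) → t ∈ openCluster (ends '' (↑(((s ∆ (E).filter (fun i => ∀ y ∈ ends i, y ∈ T))).filter (fun i => ∀ y ∈ ends i, y ∈ T)) : Set ι)) x := by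
    rw [islandSwap_filter_red ends E s hs T]; exact hblue
  have hblue' : ∀ t ∈ T, t ≠ x → (∃ i ∈ E, ∃ t', ends i = s(t, t') ∧ t' ∉ T) → t ∈ openCluster (ends '' (↑((E \ (s ∆ (E).filter (fun i => ∀ y ∈ ends i, y ∈ T))).filter (fun i => ∀ y ∈ ends i, y ∈ T)) : Set ι)) x := by
    rw [islandSwap_filter_blue ends E s hs T]; exact hred
  have A1 := mem_openCluster_iff_inter_of_island ends E s hs x (↑T : Set V) hxT' (islS s hred) hv'
  have A2 := mem_openCluster_iff_inter_of_island ends E (E \ s) Finset.sdiff_subset x (↑T : Set V) hxT' (islS (E \ s) hblue) hv'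
  have A3 := mem_openCluster_iff_inter_of_island ends E (s ∆ (E).filter (fun i => ∀ y ∈ ends i, y ∈ T)) hs' x (↑T : Set V) hxT' (islS _ hred') hv'
  have A4 := mem_openCluster_iff_inter_of_island ends E (E \ (s ∆ (E).filter (fun i => ∀ y ∈ ends i, y ∈ T))) Finset.sdiff_subset x (↑T : Set V) hxT' (islS _ hblue') hv'
  rw [eF] at A1 A2 A3 A4
  rw [islandSwap_filter_red ends E s hs T] at A3
  rw [islandSwap_filter_blue ends E s hs T] at A4
  exact ⟨A3.trans A2.symm, A4.trans A1.symm⟩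

open Classical in
/-- **The largest `u`-avoiding island is unchanged by the island swap**: `Y^u(s ∆ E_(Y^u(s))) = Y^u(s)` for `s ⊆ E`
(`x ∈ Vs`, `u ≠ x`).  [cite: KozmaNitzan2024, §5.5 (context only)] -/
theorem islandSup_islandSwap (ends : ι → Sym2 V) (E s : Finset ι) (hs : s ⊆ E) (x u : V) (Vs : Finset V) (hxV : x ∈ Vs) (hux : u ≠ x) :
    (Vs.filter (fun v : V => ∃ Y : Finset V, Y ⊆ Vs ∧ x ∈ Y ∧ u ∉ Y ∧ (∀ t ∈ Y, t ≠ x → (∃ i ∈ E, ∃ t', ends i = s(t, t') ∧ t' ∉ Y) → t ∈ openCluster (ends '' (↑(((s ∆ (E).filter (fun i => ∀ y ∈ ends i, y ∈ (Vs.filter (fun v : V => ∃ Y : Finset V, Y ⊆ Vs ∧ x ∈ Y ∧ u ∉ Y ∧ (∀ t ∈ Y, t ≠ x → (∃ i ∈ E, ∃ t', ends i = s(t, t') ∧ t' ∉ Y) → t ∈ openCluster (ends '' (↑((s).filter (fun i => ∀ y ∈ ends i, y ∈ Y)) : Set ι)) x ∧ t ∈ openCluster (ends '' (↑((E \ s).filter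 (fun i => ∀ y ∈ ends i, y ∈ Y)) : Set ι)) x) ∧ v ∈ Y))))).filter (fun i => ∀ y ∈ ends i, y ∈ Y)) : Set ι)) x ∧ t ∈ openCluster (ends '' (↑((E \ (s ∆ (E).filter (fun i => ∀ y ∈ ends i, y ∈ (Vs.filter (fun v : V => ∃ Y : Finset V, Y ⊆ Vs ∧ x ∈ Y ∧ u ∉ Y ∧ (∀ t ∈ Y, t ≠ x → (∃ i ∈ E, ∃ t', ends i = s(t, t') ∧ t' ∉ Y) → t ∈ openCluster (ends '' (↑((s).filter (fun i => ∀ y ∈ ends i, y ∈ Y)) : Set ι)) x ∧ t ∈ openCluster (ends '' (↑((E \ s).filter (fun i => ∀ y ∈ ends i, y ∈ Y)) : Set ι)) x) ∧ v ∈ Y))))).filter (fun i => ∀ y ∈ ends i, y ∈ Y)) : Set ι)) x) ∧ v ∈ Y))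
      = (Vs.filter (fun v : V => ∃ Y : Finset V, Y ⊆ Vs ∧ x ∈ Y ∧ u ∉ Y ∧ (∀ t ∈ Y, t ≠ x → (∃ i ∈ E, ∃ t', ends i = s(t, t') ∧ t' ∉ Y) → t ∈ openCluster (ends '' (↑((s).filter (fun i => ∀ y ∈ ends i, y ∈ Y)) : Set ι)) x ∧ t ∈ openCluster (ends '' (↑((E \ s).filter (fun i => ∀ y ∈ ends i, y ∈ Y)) : Set ι)) x) ∧ v ∈ Y)) := by
  set Y : Finset V := (Vs.filter (fun v : V => ∃ Y : Finset V, Y ⊆ Vs ∧ x ∈ Y ∧ u ∉ Y ∧ (∀ t ∈ Y, t ≠ x → (∃ i ∈ E, ∃ t', ends i = s(t, t') ∧ t' ∉ Y) → t ∈ openCluster (ends '' (↑((s).filter (fun i => ∀ y ∈ ends i, y ∈ Y)) : Set ι)) x ∧ t ∈ openCluster (ends '' (↑((E \ s).filter (fun i => ∀ y ∈ ends i, y ∈ Y)) : Set ι)) x) ∧ v ∈ Y)) with hYdef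
  obtain ⟨hYV, hxY, huY, hI, hmax⟩ := (islandSup_eq_iff ends E s x u Vs hxV hux Y).mp hYdef.symm
  have hs' : (s ∆ (E).filter (fun i => ∀ y ∈ ends i, y ∈ Y)) ⊆ E := islandSwap_subset ends E s hs Y
  have hI' : (∀ t ∈ Y, t ≠ x → (∃ i ∈ E, ∃ t', ends i = s(t, t') ∧ t' ∉ Y) → t ∈ openCluster (ends '' (↑(((s ∆ (E).filter (fun i => ∀ y ∈ ends i, y ∈ Y))).filter (fun i => ∀ y ∈ ends i, y ∈ Y)) : Set ι)) x ∧ t ∈ openCluster (ends '' (↑((E \ (s ∆ (E).filter (fun i => ∀ y ∈ ends i, y ∈ Y))).filter (fun i => ∀ y ∈ ends i, y ∈ Y)) : Set ι)) x) := by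
    intro t ht htx hbd
    have h := hI t ht htx hbd
    rw [islandSwap_filter_red ends E s hs Y, islandSwap_filter_blue ends E s hs Y]
    exact ⟨h.2, h.1⟩
  refine (islandSup_eq_iff ends E (s ∆ (E).filter (fun i => ∀ y ∈ ends i, y ∈ Y)) x u Vs hxV hux Y).mpr ⟨hYV, hxY, huY, hI', ?_⟩
  intro Y' hYY' hne hY'V huY' hI2
  refine hmax Y' hYY' hne hY'V huY' ?_
  have hB' := island_iff_quotient_of_subset ends E (s ∆ (E).filter (fun i => ∀ y ∈ ends i, y ∈ Y)) hs' x Y Y' hxY hYY' hI'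
  have hB := island_iff_quotient_of_subset ends E s hs x Y Y' hxY hYY' hI
  rw [islandSwap_union_red ends E s hs Y, islandSwap_union_blue ends E s hs Y] at hB'
  exact hB.mpr (hB'.mp hI2)

open Classical in
/-- **ISLAND SWAP** (memo CW-RESIDUE-gen36 §2.8): the point-row sum over the wall colourings `s ⊆ E` with `w` inside the largest
`u`-avoiding island `Y^u(s)` vanishes — `s ↦ s ∆ E_(Y^u(s))` is a wall-preserving involution there which fixes `σ_u` (read outside the
island) and negates `σ_w` (read inside). [cite: KozmaNitzan2024, Questions 8–9 (§5.5 p. 36) (context)] -/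
theorem pointRow_sum_sealed_eq_zero (ends : ι → Sym2 V) (E : Finset ι) (Vs : Finset V) (x u w : V) (Z : Set V)
    (hxV : x ∈ Vs) (hux : u ≠ x) :
    ∑ s ∈ E.powerset.filter (fun s : Finset ι => (∀ z ∈ Z, z ∉ openCluster (ends '' (↑(s) : Set ι)) x ∧ z ∉ openCluster (ends '' (↑(E \ s) : Set ι)) x) ∧
        w ∈ (Vs.filter (fun v : V => ∃ Y : Finset V, Y ⊆ Vs ∧ x ∈ Y ∧ u ∉ Y ∧ (∀ t ∈ Y, t ≠ x → (∃ i ∈ E, ∃ t', ends i = s(t, t') ∧ t' ∉ Y) → t ∈ openCluster (ends '' (↑((s).filter (fun i => ∀ y ∈ ends i, y ∈ Y)) : Set ι)) x ∧ t ∈ openCluster (ends '' (↑((E \ s).filter (fun i => ∀ y ∈ ends i, y ∈ Y)) : Set ι)) x) ∧ v ∈ Y))),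
      ((if u ∈ openCluster (ends '' (↑(s) : Set ι)) x then (1 : ℝ) else 0) - (if u ∈ openCluster (ends '' (↑(E \ s) : Set ι)) x then (1 : ℝ) else 0)) *
        ((if w ∈ openCluster (ends '' (↑(s) : Set ι)) x then (1 : ℝ) else 0) - (if w ∈ openCluster (ends '' (↑(E \ s) : Set ι)) x then (1 : ℝ) else 0))
      = 0 := by
  -- abbreviations: the maximal `u`-avoiding island and the swap
  refine Finset.sum_involution (fun s _ => s ∆ (E).filter (fun i => ∀ y ∈ ends i, y ∈ (Vs.filter (fun v : V => ∃ Y : Finset V, Y ⊆ Vs ∧ x ∈ Y ∧ u ∉ Y ∧ (∀ t ∈ Y, t ≠ x → (∃ i ∈ E, ∃ t', ends i = s(t, t') ∧ t' ∉ Y) → t ∈ openCluster (ends '' (↑((s).filter (fun i => ∀ y ∈ ends i, y ∈ Y)) : Set ι)) x ∧ t ∈ openCluster (ends '' (↑((E \ s).filter (fun i => ∀ y ∈ ends i, y ∈ Y)) : Set ι)) x) ∧ v ∈ Y)))) ?_ ?_ ?_ ?_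
  · -- f s + f (ψ s) = 0
    intro s hs
    rw [Finset.mem_filter, Finset.mem_powerset] at hs
    obtain ⟨hsE, -, hwY⟩ := hs
    obtain ⟨-, hxY, huY, hI, -⟩ := (islandSup_eq_iff ends E s x u Vs hxV hux _).mp rfl
    have hout := islandSwap_outside ends E s hsE x _ hxY hI huY
    have hin := islandSwap_inside ends E s hsE x _ hxY hI hwY
    rw [hout.1, hout.2, hin.1, hin.2]
    ring
  · -- nonzero summands are moved
    intro s hs hne heq
    apply hne
    rw [Finset.mem_filter, Finset.mem_powerset] at hs
    obtain ⟨hsE, -, hwY⟩ := hs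
    obtain ⟨-, hxY, huY, hI, -⟩ := (islandSup_eq_iff ends E s x u Vs hxV hux _).mp rfl
    have hin := islandSwap_inside ends E s hsE x _ hxY hI hwY
    have e1 : (w ∈ openCluster (ends '' (↑(s) : Set ι)) x ↔ w ∈ openCluster (ends '' (↑(E \ s) : Set ι)) x) := by
      constructor
      · intro h; have h2 := hin.2.mpr h; rwa [heq] at h2
      · intro h; have h1 := hin.1.mpr h; rwa [heq] at h1
    by_cases hw : w ∈ openCluster (ends '' (↑(s) : Set ι)) x
    · rw [if_pos hw, if_pos (e1.mp hw)]; ring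
    · rw [if_neg hw, if_neg (fun h => hw (e1.mpr h))]; ring
  · -- ψ s is again a sealed wall colouring
    intro s hs
    rw [Finset.mem_filter, Finset.mem_powerset] at hs ⊢
    obtain ⟨hsE, hW, hwY⟩ := hs
    obtain ⟨-, hxY, huY, hI, -⟩ := (islandSup_eq_iff ends E s x u Vs hxV hux _).mp rfl
    have hfix := islandSup_islandSwap ends E s hsE x u Vs hxV hux
    refine ⟨islandSwap_subset ends E s hsE _, ?_, ?_⟩
    · intro z hz
      by_cases hzY : z ∈ (Vs.filter (fun v : V => ∃ Y : Finset V, Y ⊆ Vs ∧ x ∈ Y ∧ u ∉ Y ∧ (∀ t ∈ Y, t ≠ x → (∃ i ∈ E, ∃ t', ends i = s(t, t') ∧ t' ∉ Y) → t ∈ openCluster (ends '' (↑((s).filter (fun i => ∀ y ∈ ends i, y ∈ Y)) : Set ι)) x ∧ t ∈ openCluster (ends '' (↑((E \ s).filter (fun i => ∀ y ∈ ends i, y ∈ Y)) : Set ι)) x) ∧ v ∈ Y))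
      · have hin := islandSwap_inside ends E s hsE x _ hxY hI hzY
        rw [hin.1, hin.2]
        exact ⟨(hW z hz).2, (hW z hz).1⟩
      · have hout := islandSwap_outside ends E s hsE x _ hxY hI hzY
        rw [hout.1, hout.2]
        exact hW z hz
    · rw [hfix]; exact hwY
  · -- ψ is an involution
    intro s hs
    rw [Finset.mem_filter, Finset.mem_powerset] at hs
    obtain ⟨hsE, -, -⟩ := hs
    have hfix := islandSup_islandSwap ends E s hsE x u Vs hxV hux
    have key : (s ∆ (E).filter (fun i => ∀ y ∈ ends i, y ∈ (Vs.filter (fun v : V => ∃ Y : Finset V, Y ⊆ Vs ∧ x ∈ Y ∧ u ∉ Y ∧ (∀ t ∈ Y, t ≠ x → (∃ i ∈ E, ∃ t', ends i = s(t, t') ∧ t' ∉ Y) → t ∈ openCluster (ends '' (↑((s).filter (fun i => ∀ y ∈ ends i, y ∈ Y)) : Set ι)) x ∧ t ∈ openCluster (ends '' (↑((E \ s).filter (fun i => ∀ y ∈ ends i, y ∈ Y)) : Set ι)) x) ∧ v ∈ Y)))) ∆ (E).filter (fun i => ∀ y ∈ ends i, y ∈ (Vs.filter (fun v : V => ∃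 Y : Finset V, Y ⊆ Vs ∧ x ∈ Y ∧ u ∉ Y ∧ (∀ t ∈ Y, t ≠ x → (∃ i ∈ E, ∃ t', ends i = s(t, t') ∧ t' ∉ Y) → t ∈ openCluster (ends '' (↑(((s ∆ (E).filter (fun i => ∀ y ∈ ends i, y ∈ (Vs.filter (fun v : V => ∃ Y : Finset V, Y ⊆ Vs ∧ x ∈ Y ∧ u ∉ Y ∧ (∀ t ∈ Y, t ≠ x → (∃ i ∈ E, ∃ t', ends i = s(t, t') ∧ t' ∉ Y) → t ∈ openCluster (ends '' (↑((s).filter (fun i => ∀ y ∈ ends i, y ∈ Y)) : Set ι)) x ∧ t ∈ openCluster (ends '' (↑((E \ s).filter (fun i => ∀ y ∈ ends i, y ∈ Y)) : Set ι)) x) ∧ v ∈ Y))))).filter (fun i => ∀ y ∈ ends i, y ∈ Y)) : Set ι)) x ∧ t ∈ openCluster (ends '' (↑((E \ (s ∆ (E).filter (fun i => ∀ y ∈ ends i, y ∈ (Vs.filter (fun v : V => ∃ Y : Finset V, Y ⊆ Vs ∧ x ∈ Y ∧ u ∉ Y ∧ (∀ t ∈ Y, t ≠ x → (∃ i ∈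 E, ∃ t', ends i = s(t, t') ∧ t' ∉ Y) → t ∈ openCluster (ends '' (↑((s).filter (fun i => ∀ y ∈ ends i, y ∈ Y)) : Set ι)) x ∧ t ∈ openCluster (ends '' (↑((E \ s).filter (fun i => ∀ y ∈ ends i, y ∈ Y)) : Set ι)) x) ∧ v ∈ Y))))).filter (fun i => ∀ y ∈ ends i, y ∈ Y)) : Set ι)) x) ∧ v ∈ Y))) = s := by
      rw [hfix]; exact symmDiff_symmDiff_cancel_right _ s
    exact key

open Classical in
/-- **The point row lives on the unsealed colourings**: `P = Σ_(s : wall, w ∉ Y^u(s)) σ_u σ_w`. [cite: KozmaNitzan2024, Questions 8–9 (§5.5 p. 36) (context)] -/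
theorem pointRow_eq_sum_unsealed (ends : ι → Sym2 V) (E : Finset ι) (Vs : Finset V) (x u w : V) (Z : Set V)
    (hxV : x ∈ Vs) (hux : u ≠ x) :
    ∑ s ∈ E.powerset.filter (fun s : Finset ι => (∀ z ∈ Z, z ∉ openCluster (ends '' (↑(s) : Set ι)) x ∧ z ∉ openCluster (ends '' (↑(E \ s) : Set ι)) x)),
      ((if u ∈ openCluster (ends '' (↑(s) : Set ι)) x then (1 : ℝ) else 0) - (if u ∈ openCluster (ends '' (↑(E \ s) : Set ι)) x then (1 : ℝ) else 0)) *
        ((if w ∈ openCluster (ends '' (↑(s) : Set ι)) x then (1 : ℝ) else 0) - (if w ∈ openCluster (ends '' (↑(E \ s) : Set ι)) x then (1 : ℝ) else 0))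
    = ∑ s ∈ E.powerset.filter (fun s : Finset ι => (∀ z ∈ Z, z ∉ openCluster (ends '' (↑(s) : Set ι)) x ∧ z ∉ openCluster (ends '' (↑(E \ s) : Set ι)) x) ∧
        w ∉ (Vs.filter (fun v : V => ∃ Y : Finset V, Y ⊆ Vs ∧ x ∈ Y ∧ u ∉ Y ∧ (∀ t ∈ Y, t ≠ x → (∃ i ∈ E, ∃ t', ends i = s(t, t') ∧ t' ∉ Y) → t ∈ openCluster (ends '' (↑((s).filter (fun i => ∀ y ∈ ends i, y ∈ Y)) : Set ι)) x ∧ t ∈ openCluster (ends '' (↑((E \ s).filter (fun i => ∀ y ∈ ends i, y ∈ Y)) : Set ι)) x) ∧ v ∈ Y))),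
      ((if u ∈ openCluster (ends '' (↑(s) : Set ι)) x then (1 : ℝ) else 0) - (if u ∈ openCluster (ends '' (↑(E \ s) : Set ι)) x then (1 : ℝ) else 0)) *
        ((if w ∈ openCluster (ends '' (↑(s) : Set ι)) x then (1 : ℝ) else 0) - (if w ∈ openCluster (ends '' (↑(E \ s) : Set ι)) x then (1 : ℝ) else 0)) := by
  have hsplit := (Finset.sum_filter_add_sum_filter_not (E.powerset.filter (fun s : Finset ι => (∀ z ∈ Z, z ∉ openCluster (ends '' (↑(s) : Set ι)) x ∧ z ∉ openCluster (ends '' (↑(E \ s) : Set ι)) x)))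
    (fun s : Finset ι => w ∈ (Vs.filter (fun v : V => ∃ Y : Finset V, Y ⊆ Vs ∧ x ∈ Y ∧ u ∉ Y ∧ (∀ t ∈ Y, t ≠ x → (∃ i ∈ E, ∃ t', ends i = s(t, t') ∧ t' ∉ Y) → t ∈ openCluster (ends '' (↑((s).filter (fun i => ∀ y ∈ ends i, y ∈ Y)) : Set ι)) x ∧ t ∈ openCluster (ends '' (↑((E \ s).filter (fun i => ∀ y ∈ ends i, y ∈ Y)) : Set ι)) x) ∧ v ∈ Y)))
    (fun s : Finset ι => ((if u ∈ openCluster (ends '' (↑(s) : Set ι)) x then (1 : ℝ) else 0) - (if u ∈ openCluster (ends '' (↑(E \ s) : Set ι)) x then (1 : ℝ) else 0)) *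
        ((if w ∈ openCluster (ends '' (↑(s) : Set ι)) x then (1 : ℝ) else 0) - (if w ∈ openCluster (ends '' (↑(E \ s) : Set ι)) x then (1 : ℝ) else 0)))).symm
  rw [Finset.filter_filter, Finset.filter_filter] at hsplit
  rw [hsplit, pointRow_sum_sealed_eq_zero ends E Vs x u w Z hxV hux, zero_add]

end Coefficientwise

end Summit.CriticalPhenomena.PercolationContinuityZ3.Theorems
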